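import Summits.HodgeConjecture.HodgeConjecture.Theorems.WeilTypeLadderTwistEigenCalculus
import Literature.AlgebraicGeometry.Milne1999.LefschetzGroupCentraliserInclusion
import Literature.AlgebraicGeometry.HodgeTheory.KaehlerClassPullbackAutomorphism
import Literature.AlgebraicGeometry.HodgeTheory.HodgeRiemannPolarizabilityProofs
import Literature.AlgebraicGeometry.HodgeTheory.HodgeClassOfMorphismProofs
import HarnessLib

/-!
# Weil-type ladder — THEOREM EXC (iii) in every rank: the invariant Kähler class and the invariant polarization pairing

b2b cell `hweil` (packet `run/shared/lean/b2b/hodge-weil/`), prover 3, report `b2b-hweil-pv3-g48/TWIST-LEFSCHETZ.md` §3.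
For a complex abelian variety `B` and an endomorphism `s` of finite order `m` (`s^m = 𝟙`):

* `exists_invariant_rational_kaehlerClass` — there is a RATIONAL KÄHLER class `h ∈ H²(B(ℂ); ℂ)` with `s^* h = h`:
  the orbit sum `Σ_{k<m} (s^k)^* η` of the rational Kähler class `η` of a Kähler–rational datum (tree:
  `nonempty_kaehlerRationalDatum`, `HodgeModel.IsKaehlerClassVia.sum_map_of_comp_eq_id`).
* `polarizationPairingOne_map_map_of_map_eq` — for a Kähler class `h` with `s^* h = h`, Milne's polarization pairing
  `Q_h(x, y) = h^{dim B - 1} ⌣ x ⌣ y` is `s^*`-INVARIANT: `s^*` fixes `h^{dim B} ≠ 0` in the top line `H^{2 dim B} =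
  ⋀^{2 dim B} H¹`, on which `⋀ s^*` is `det s^*`, so `det s^* = 1` (the argument of the tree's
  `Milne1999.apply_one_mem_unitaryCentralizerGroup_of_eq_sum`, second half, with `s^*` in place of `g₁`).
* `apply_mem_eigenspace_pow_of_twist` — a twisting operator `U ∘ T = T^u ∘ U` (`T^m = 1`, `u² ≡ 1 (m)`) carries the
  eigenspace `V_ν` of `T` into `V_{ν^u}`.

No named fact, no definition, no `sorry`. [cite: Milne1999LefschetzClasses, §1 p. 644 and Thm. 4.4 (p. 659)]
[cite: VoisinHodgeI2002, §3.1.3 and §7.1.2] [cite: LangeBirkenhake1992, Lemma 1.1.17]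
-/

noncomputable section

-- every declaration of this problem lives in `Summit.HodgeConjecture.HodgeConjecture.…` (summit = sub-problem)
set_option linter.dupNamespace false

open CategoryTheory
open Literature.AlgebraicGeometry Literature.AlgebraicGeometry.Motives
open Literature.AlgebraicGeometry.HodgeTheory
open Literature.AlgebraicTopology.SingularHomology
open Literature.AlgebraicGeometry.Milne1999

namespace Summit.HodgeConjecture.HodgeConjecture.WeilTypeLadder

section Twist

variable {V : Type*} [AddCommGroup V] [Module ℂ V]

/-- **A twisting operator permutes eigenspaces**: if `U (T x) = T^u (U x)`, `T^m = 1`, `u² ≡ 1 (mod m)`, then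
`U` carries `ker(T - ν)` into `ker(T - ν^u)` (`T = (T^u)^u` since `u² = 1 + km` and `T^m = 1`). [folklore] -/
theorem apply_mem_eigenspace_pow_of_twist (T U : Module.End ℂ V) {m u : ℕ} (hm : 2 ≤ m)
    (hu : u * u ≡ 1 [MOD m]) (hTm : T ^ m = 1) (hUT : ∀ x, U (T x) = (T ^ u) (U x)) {ν : ℂ} {x : V}
    (hx : x ∈ Module.End.eigenspace T ν) : U x ∈ Module.End.eigenspace T (ν ^ u) := by
  rw [Module.End.mem_eigenspace_iff] at hx ⊢
  obtain ⟨k, hk⟩ := exists_mul_self_eq_of_modEq hm hu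
  have h1 : T = (T ^ u) ^ u := by
    rw [← pow_mul, hk, pow_add, pow_mul, hTm, one_pow, one_mul, pow_one]
  have h2 : (T ^ u) (U x) = ν • U x := by rw [← hUT, hx, map_smul]
  conv_lhs => rw [h1]
  exact pow_apply_of_apply_eq_smul (T ^ u) h2 u

end Twist

section Kaehler

variable (B : AbelianVariety ℂ) (s : B ⟶ B)

/-- In `End B`: `(s^a).asHom ≫ (s^b).asHom = (s^(b+a))… = (s^(a+b)).asHom` (composition is multiplication in the
opposite order, powers commute). [folklore] -/
theorem asHom_pow_comp_asHom_pow (a b : ℕ) :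
    CategoryTheory.End.asHom (CategoryTheory.End.of s ^ a) ≫ CategoryTheory.End.asHom (CategoryTheory.End.of s ^ b) =
      CategoryTheory.End.asHom (CategoryTheory.End.of s ^ (a + b)) := by
  change CategoryTheory.End.of s ^ b * CategoryTheory.End.of s ^ a = CategoryTheory.End.of s ^ (a + b)
  rw [← pow_add, add_comm]

/-- `s ≫ (s^k).asHom = (s^(k+1)).asHom`. [folklore] -/
theorem comp_asHom_pow (k : ℕ) :
    s ≫ CategoryTheory.End.asHom (CategoryTheory.End.of s ^ k) =
      CategoryTheory.End.asHom (CategoryTheory.End.of s ^ (k + 1)) := by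
  change CategoryTheory.End.of s ^ k * CategoryTheory.End.of s = CategoryTheory.End.of s ^ (k + 1)
  rw [pow_succ]

/-- **An `s`-invariant rational Kähler class.** For an endomorphism `s` of a complex abelian variety `B` with
`s^m = 𝟙` (`m ≥ 1`) there is a class `h ∈ H²(B(ℂ); ℂ)` which is RATIONAL, KÄHLER, and fixed by `s^*`: the orbit
sum `h = Σ_{k<m} (s^k)^* η` of the rational Kähler class `η` of a Kähler–rational datum of `B` (each `s^k` has the
retraction `s^{m-k}`, so each `(s^k)^* η` is Kähler for the same model, and Kähler classes of one model add).
[cite: VoisinHodgeI2002, §3.1.3 and §7.1.2, Thm. 7.10] -/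
theorem exists_invariant_rational_kaehlerClass {m : ℕ} (hm : 0 < m) (hsm : CategoryTheory.End.of s ^ m = 1) :
    ∃ h : complexBetti B.X 2, IsRationalClass h ∧ IsKaehlerClass B.dim B.X h ∧
      complexBetti.map s.hom.hom.hom 2 h = h := by
  classical
  have hX : IsSmoothProjective B.dim B.X := AbelianVariety.isSmoothProjective_holds (A := B)
  obtain ⟨D⟩ := nonempty_kaehlerRationalDatum hX
  -- the orbit of `η` under the powers of `s`
  let φ : ℕ → (B.X ⟶ B.X) := fun k =>
    (CategoryTheory.End.asHom (CategoryTheory.End.of s ^ k) : B ⟶ B).hom.hom.hom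
  let ψ : ℕ → (B.X ⟶ B.X) := fun k =>
    (CategoryTheory.End.asHom (CategoryTheory.End.of s ^ (m - k)) : B ⟶ B).hom.hom.hom
  have hφψ : ∀ k ∈ Finset.range m, φ k ≫ ψ k = 𝟙 B.X := by
    intro k hk
    have hkm : k ≤ m := (Finset.mem_range.1 hk).le
    change (CategoryTheory.End.asHom (CategoryTheory.End.of s ^ k) ≫
      CategoryTheory.End.asHom (CategoryTheory.End.of s ^ (m - k)) : B ⟶ B).hom.hom.hom = (𝟙 B : B ⟶ B).hom.hom.hom
    rw [asHom_pow_comp_asHom_pow, Nat.add_sub_cancel' hkm, hsm]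
    rfl
  let a : ℕ → complexBetti B.X 2 := fun k => complexBetti.map (φ k) 2 D.Hη
  refine ⟨∑ k ∈ Finset.range m, a k, ?_, ?_, ?_⟩
  · -- rational
    exact isRationalClass_sum _ _ fun k _ => D.isRationalClass_Hη.map _
  · -- Kähler
    exact (D.isKaehlerClassVia.sum_map_of_comp_eq_id D.isNatural hX (Finset.nonempty_range_iff.2 hm.ne') φ ψ
      hφψ).isKaehlerClass D.isNatural D.isMultiplicative
  · -- `s^*`-invariant: `s^* (s^k)^* η = (s^{k+1})^* η` and `s^m = s^0`
    have hstep : ∀ k, complexBetti.map s.hom.hom.hom 2 (a k) = a (k + 1) := by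
      intro k
      change singularCohomology.map ℂ ℂ (Motives.AlgPoints.mapContinuous (L := ℂ) s.hom.hom.hom) 2
          (singularCohomology.map ℂ ℂ (Motives.AlgPoints.mapContinuous (L := ℂ)
            (CategoryTheory.End.asHom (CategoryTheory.End.of s ^ k) : B ⟶ B).hom.hom.hom) 2 D.Hη) =
        singularCohomology.map ℂ ℂ (Motives.AlgPoints.mapContinuous (L := ℂ)
          (CategoryTheory.End.asHom (CategoryTheory.End.of s ^ (k + 1)) : B ⟶ B).hom.hom.hom) 2 D.Hη
      rw [abelianVariety_map_map_apply, comp_asHom_pow]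
    have hper : a m = a 0 := by
      change singularCohomology.map ℂ ℂ (Motives.AlgPoints.mapContinuous (L := ℂ)
          (CategoryTheory.End.asHom (CategoryTheory.End.of s ^ m) : B ⟶ B).hom.hom.hom) 2 D.Hη =
        singularCohomology.map ℂ ℂ (Motives.AlgPoints.mapContinuous (L := ℂ)
          (CategoryTheory.End.asHom (CategoryTheory.End.of s ^ 0) : B ⟶ B).hom.hom.hom) 2 D.Hη
      rw [hsm, pow_zero]
    rw [map_sum]
    simp_rw [hstep]
    have h1 := Finset.sum_range_succ' a m
    have h2 := Finset.sum_range_succ a m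
    rw [hper] at h2
    exact add_right_cancel (h1.symm.trans h2)

/-- **The polarization pairing of an `s`-invariant Kähler class is `s^*`-invariant.** For a Kähler class `h` of
the abelian variety `B` (`dim B ≥ 1`) with `s^* h = h`, `Q_h(s^* x, s^* y) = Q_h(x, y)` for all `x, y ∈ H¹(B(ℂ); ℂ)`,
`Q_h(x, y) = h^{dim B - 1} ⌣ x ⌣ y` (`Motives.polarizationPairingOne`). Proof: on `H• = ⋀• H¹` the pull-back `s^*`
is `⋀ s^*|_{H¹}`; it fixes `h`, hence `h^{dim B} ≠ 0` (Kähler), and acts on the top line by `det s^*`, so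
`det s^* = 1` and `s^*(h^{dim B-1} ⌣ x ⌣ y) = h^{dim B - 1} ⌣ s^*x ⌣ s^*y` is again `⋀^{2 dim B} s^* = det = 1`
applied to `Q_h(x, y)`. [cite: Milne1999LefschetzClasses, Thm. 4.4 (p. 659)] [cite: LangeBirkenhake1992, Lemma 1.1.17] -/
theorem polarizationPairingOne_map_map_of_map_eq {h : complexBetti B.X 2} (hK : IsKaehlerClass B.dim B.X h)
    (hB : 0 < B.dim) (hsh : complexBetti.map s.hom.hom.hom 2 h = h) (x y : complexBetti B.X 1) :
    polarizationPairingOne B.X h (B.dim - 1) ((complexBetti.map s.hom.hom.hom 1).hom x)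
        ((complexBetti.map s.hom.hom.hom 1).hom y) =
      polarizationPairingOne B.X h (B.dim - 1) x y := by
  have hX : IsSmoothProjective B.dim B.X := AbelianVariety.isSmoothProjective_holds (A := B)
  have hΛ := AbelianVariety.hasExteriorCohomologyH1_complexPoints B
  set T : complexBetti B.X 1 →ₗ[ℂ] complexBetti B.X 1 := (complexBetti.map s.hom.hom.hom 1).hom with hT
  have hT2 : exteriorPullback hΛ T 2 h = h := by
    rw [hT, exteriorPullback_map_apply]
    exact hsh
  have hpow : cupPowTwo h B.dim ≠ 0 := hK.cupPowTwo_ne_zero hX hB le_rfl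
  have hdet : LinearMap.det T = 1 := by
    have e := Milne1999.exteriorPullback_cupPowTwo hΛ hT2 B.dim
    rw [exteriorPullback_top hΛ _ (AbelianVariety.finrank_complexBetti_one B)] at e
    exact smul_left_injective ℂ hpow (e.trans (one_smul ℂ _).symm)
  have hxy : cupProduct (rfl : 1 + 1 = 2) (T x) (T y) =
      exteriorPullback hΛ T 2 (cupProduct (rfl : 1 + 1 = 2) x y) := by
    rw [exteriorPullback_cupProduct_one_one]
  rw [polarizationPairingOne_apply, polarizationPairingOne_apply, hxy,
    ← exteriorPullback_lefschetzPow hΛ hT2 2 _ (B.dim - 1),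
    exteriorPullback_top hΛ _ (d := 2 + 2 * (B.dim - 1))
      (by rw [AbelianVariety.finrank_complexBetti_one]; omega), hdet, one_smul]

end Kaehler

end Summit.HodgeConjecture.HodgeConjecture.WeilTypeLadder

end
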